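import Summits.HubbardSuperconductivity.HubbardSuperconductivity.Theorems.AnisotropyChordTransferFibre3GM3Cellwise
import Summits.HubbardSuperconductivity.HubbardSuperconductivity.Theorems.AnisotropyChordTransferFibre3N1RowL2Cover
import Summits.HubbardSuperconductivity.HubbardSuperconductivity.Theorems.AnisotropyChordTransferFibre3AssemblyHole2

/-!
# Route `AnisotropyChord` / H0 rotor rung, LEVEL 2 (`∀ L ≥ 128`): the per-cell CLOSURE unit of the GM₃ window

`gm3_cellwise` (`…GM3Cellwise`) asks, for every ground two-magnon profile of `(L, Δ)`, for SOME constants `c, a, b` with the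
windowed regime clause `0 ≤ mHole ∧ facMI·η_eff·(a + b/(2 + cos θ)) < c` and the three β-free rows `c·U ≤ N₁` (KT-1″),
`lowG ≤ a·η_eff·U` (KT-2a″), `‖R′‖² − P − lowN ≤ b·η_eff·(2ε₁ − T⁺)·U` (KT-2b″).  The four Level-2 kernel campaigns certify
these CELL BY CELL in `(ν, a)` with their own constants: side cells `hreg_cellN…` (`a_s, b_s, c_s`), row `N₁` cells
`trialGap(S)_…` (`c_N`), row-C cells `offPoleTail(T)_cellN…` (`b_C`), row-D cells `lowG_cellN{S,W,D}…` (`a_D`), on boxes that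
need not coincide.  This file is the glue that turns four such facts on boxes containing a cell into the `∃ c a b` unit:
★ `etaEff_nonneg`, ★ `Uunit_nonneg'`, the monotonicities ★ `lowG_mono` (`a_D ≤ a`), ★ `offPoleTail_mono` (`b_C ≤ b`, using
`T⁺ < 2ε₁` from `mHole ≥ 0`), and ★★ `cell_closed`: side `(a_s,b_s,c_s)` + `N₁` with `c_N ≥ c_s` + row D with `a_D ≤ a_s`
+ row C with `b_C ≤ b_s` ⟹ `∃ c a b, …` (the hypothesis of `gm3_cellwise` at that profile).  The per-cell files
`…L2ClosedN<col><cell>.lean` instantiate it; a cover of the `(ν, a)` band by closed cells then gives `GM3Fibre L Δ` for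
every `L ≥ 128` by `gm3_cellwise`.
Prover seat `hubbard-h0-rotor-p1` g31 (route lead); helper for piece A = stmt-HubbardSuperconductivity-23918 of rung 19089
(`--supports`, helper class).  Nothing here proves superconductivity in the Hubbard model; glue lemmas for ONE conditional
reduction (the GM₃ ∀L certificate).  Tree imports only; no sorry.
-/

set_option linter.dupNamespace false
set_option autoImplicit false

namespace Summit.HubbardSuperconductivity.HubbardSuperconductivity.Theorems.AnisotropyChord.Transfer.Fibre3

namespace L2

variable (L : ℕ) [NeZero L]

/-- `η_eff = Vλ₂/4 ≥ 0` at a ground profile (`λ₂ > 0` for `Δ < 1`, `L ≥ 3`). [folklore] -/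
theorem etaEff_nonneg (hL : 3 ≤ L) {Δ lam2 : ℝ} (hΔ1 : Δ < 1) {f : Tor L → ℝ} (hf : IsGroundTwoMagnon L Δ lam2 f) :
    0 ≤ etaEff L lam2 := by
  have hlam : 0 < lam2 := lam2_pos L hL hΔ1 hf.1
  unfold etaEff; positivity

/-- `U = 3V²T⁺ ≥ 0` at a ground profile (`Δ ≤ 1`, `L ≥ 2`). [folklore] -/
theorem Uunit_nonneg' (hL : 2 ≤ L) {Δ lam2 : ℝ} (hΔ1 : Δ ≤ 1) {f : Tor L → ℝ} (hf : IsGroundTwoMagnon L Δ lam2 f) :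
    0 ≤ Uunit L Δ f := by
  unfold Uunit; exact mul_nonneg (by positivity) (Tplus_nonneg L hL hΔ1 hf)

/-- ★ raising the row-D constant: `lowG ≤ a·η_eff·U` and `a ≤ a′` give `lowG ≤ a′·η_eff·U`. [folklore] -/
theorem lowG_mono (hL : 3 ≤ L) {Δ lam2 : ℝ} (hΔ1 : Δ < 1) {f : Tor L → ℝ} (hf : IsGroundTwoMagnon L Δ lam2 f)
    {a a' : ℝ} (haa : a ≤ a') (h : lowGForm L Δ f ≤ a * etaEff L lam2 * Uunit L Δ f) :
    lowGForm L Δ f ≤ a' * etaEff L lam2 * Uunit L Δ f := by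
  have hη := etaEff_nonneg L hL hΔ1 hf
  have hU := Uunit_nonneg' L (by omega) hΔ1.le hf
  exact h.trans (mul_le_mul_of_nonneg_right (mul_le_mul_of_nonneg_right haa hη) hU)

/-- ★ raising the row-C constant: `X ≤ b·η_eff·(2ε₁ − T⁺)·U` and `b ≤ b′` give `X ≤ b′·η_eff·(2ε₁ − T⁺)·U`
(`2ε₁ − T⁺ > 0` from `mHole ≥ 0`, `L ≥ 4`). [folklore] -/
theorem offPoleTail_mono (hL : 4 ≤ L) {Δ lam2 : ℝ} (hΔ1 : Δ < 1) {f : Tor L → ℝ} (hf : IsGroundTwoMagnon L Δ lam2 f)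
    (hm : 0 ≤ mHole L Δ f) {b b' : ℝ} (hbb : b ≤ b') {X : ℝ}
    (h : X ≤ b * etaEff L lam2 * (2 * eps1 L - Tplus L Δ f) * Uunit L Δ f) :
    X ≤ b' * etaEff L lam2 * (2 * eps1 L - Tplus L Δ f) * Uunit L Δ f := by
  have hη := etaEff_nonneg L (by omega) hΔ1 hf
  have hU := Uunit_nonneg' L (by omega) hΔ1.le hf
  have hT : 0 ≤ 2 * eps1 L - Tplus L Δ f := by
    have := Tplus_lt_of_mHole_nonneg L hL hm; linarith
  refine h.trans ?_
  have : 0 ≤ etaEff L lam2 * (2 * eps1 L - Tplus L Δ f) * Uunit L Δ f := by positivity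
  nlinarith

/-- ★★ **THE CLOSURE UNIT**: a side cell with constants `(a_s, b_s, c_s)`, a row-`N₁` fact with `c_N ≥ c_s`, a row-D fact with
`a_D ≤ a_s` and a row-C fact with `b_C ≤ b_s`, all at the same ground profile, give the `∃ c a b` hypothesis of `gm3_cellwise`
at that profile. [folklore] -/
theorem cell_closed (hL : 4 ≤ L) {Δ lam2 : ℝ} (hΔ1 : Δ < 1) {f : Tor L → ℝ} (hf : IsGroundTwoMagnon L Δ lam2 f)
    {aS bS cS cN aD bC : ℝ}
    (hreg : 0 ≤ mHole L Δ f ∧ facMI L Δ f * etaEff L lam2 * (aS + bS / (2 + Real.cos (2 * Real.pi / L))) < cS)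
    (h1 : cN * Uunit L Δ f ≤ trialGapN1 L Δ f) (hc : cS ≤ cN)
    (h2a : lowGForm L Δ f ≤ aD * etaEff L lam2 * Uunit L Δ f) (ha : aD ≤ aS)
    (h2b : (ip L (resid L Δ f) (resid L Δ f)).re - polePart L Δ f - lowNormPart L Δ f
      ≤ bC * etaEff L lam2 * (2 * eps1 L - Tplus L Δ f) * Uunit L Δ f) (hb : bC ≤ bS) :
    ∃ c a b : ℝ,
      (0 ≤ mHole L Δ f ∧ facMI L Δ f * etaEff L lam2 * (a + b / (2 + Real.cos (2 * Real.pi / L))) < c) ∧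
      c * Uunit L Δ f ≤ trialGapN1 L Δ f ∧
      lowGForm L Δ f ≤ a * etaEff L lam2 * Uunit L Δ f ∧
      (ip L (resid L Δ f) (resid L Δ f)).re - polePart L Δ f - lowNormPart L Δ f
        ≤ b * etaEff L lam2 * (2 * eps1 L - Tplus L Δ f) * Uunit L Δ f :=
  ⟨cS, aS, bS, hreg, L2.N1.trialGap_mono L hΔ1.le hf (by omega) hc h1, lowG_mono L (by omega) hΔ1 hf ha h2a,
    offPoleTail_mono L hL hΔ1 hf hreg.1 hb h2b⟩

end L2

end Summit.HubbardSuperconductivity.HubbardSuperconductivity.Theorems.AnisotropyChord.Transfer.Fibre3
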